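import Summits.QuantumFields.YangMills.Theorems.FluctuationComparisonRegPrIntLS2BetaOneStepShift
import Summits.QuantumFields.YangMills.Theorems.UnitScaleTiltProp7AxialGauge
import Summits.QuantumFields.YangMills.Theorems.UnitScaleTiltProp7AxialGaugeBlock
import HarnessLib

/-!
# GAP♯∘'s KINEMATIC LETTER — THE INTRA-BLOCK HALF OF [Balaban1985RegularSpaces] LEMMA 1 DISCHARGED: ONE-STEP-ROOTED₀∘ ⟸ INTER₀∘ (crossing bonds only)
# (crux `FluctuationComparisonRegPrIntL`, stmt-QuantumFields-20520; registry v11.4 `Cruxes/FluctuationComparisonRegPrIntL/Lines/semiclassical_s2beta.lean` 3732b7df FROZEN, untouched)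

Cell `ym3-torus` (YM ladder rung R3 = continuum `SU(2)` Yang–Mills on the three-torus — a RUNG: NOT d = 4, NOT infinite volume, NOT a mass gap, NOT Clay).
Seat `ymfull-r3-prover-3` (gen 0; R590-ym (a) item (3)); `--kind proof --supports stmt-QuantumFields-20520 --as helper`, count-neutral, DEFINITION-FREE (0 `def`, 0 `instance`,
0 `notation`, 0 `sorry`, default heartbeats).  Seventh file of the seat; sits on ✓`…S2BetaOneStepShift` (`closePair_of_oneStepRooted₀`) and on the 19200 lane's comb-axial files
✓`UnitScaleTiltProp7AxialGauge` ∕ ✓`UnitScaleTiltProp7AxialGaugeBlock` (px∕p1 lineage).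

WHAT.  ONE-STEP-ROOTED₀∘ asks, on the finest lattice of a run, for a ROOTED transformation making two small-plaquette fields with `α₁`-close one-step averages
`(α₁ + C·α₀)`-close on EVERY bond.  Print's proof ([Balaban1985RegularSpaces] Lemma 1 pp.79–80) takes the comb-axial gauge of `Y′` relative to `Y` inside the rooted group and
splits the bonds: (i) bonds INSIDE a block — comb-fan Stokes, `|…| ≤ d(L−1)·2α₀`, which the tree HAS: ✓`Prop7AxialGauge.exists_axialGauge` (the rooted element, `k = 1`) and
✓`Prop7AxialGaugeBlock.dist1_mul_inv_le_interior` (the interior bound); (ii) bonds JOINING two blocks — «(1.25) on the bonds of B_j(c), from |V̄′ − V̄₀′| < α₁», the averaging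
constraint: each crossing bond is within `C·α₀` of its block average — the recorded TODO of ✓`Prop7AxialGaugeBlock`.  This file discharges (i) and displays (ii) alone:

* **INTER₀∘** (displayed) — `∀ L, ∃ C ≥ 0, ∃ a₀ > 0, ∀ F (F.L = L) K′ (0 < K′) (W Y : GaugeField (F.P K′) 0 SU(2)) α₀ ∈ [0,a₀] α₁ ≥ 0`, `PlaqSmall α₀ Y → PlaqSmall α₀ W →`
  `(W comb-axial relative to Y: ∀ x, axialT W (embIter 1 (iterBlockOf 1 x)) x = axialT Y (embIter 1 (iterBlockOf 1 x)) x) →`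
  `(∀ b : PBond _ 1, dist1((avg W) b·((avg Y) b)⁻¹) ≤ α₁) → ∀ x μ, iterBlockOf 1 (x.shift μ) ≠ iterBlockOf 1 x → dist1(W ⟨x,μ⟩·(Y ⟨x,μ⟩)⁻¹) ≤ α₁ + C·α₀`.
* §1 ★★ `oneStepRooted₀_of_interBlock (hI : ⟨INTER₀∘⟩) : ⟨ONE-STEP-ROOTED₀∘ VERBATIM⟩` — constant `C + 6L` (`6(L−1) ≤ 6L` absorbs the interior bound, `d = 3`); the rooted element
  `v` of ✓`exists_axialGauge` gauges `Y′` to `W := Y′^v` (same averages: `v ∘ emb ≡ 1`, ✓`Averaging.covariant` + ✓`gaugeAct_one'`; same plaquette classes), interior bonds by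
  ✓`dist1_mul_inv_le_interior`, crossing bonds by INTER₀∘, and `w := v⁻¹` (`Y′ ℓ·((v⁻¹•Y) ℓ)⁻¹` is a conjugate of `W ℓ·(Y ℓ)⁻¹`: `dist1_conj`).
* §2 ★★★ `closePair_of_interBlock (hI) : ⟨CLOSE-PAIR∘ VERBATIM⟩` := ✓`closePair_of_oneStepRooted₀` ∘ §1.

NET (CREDIT NOTHING): «CLOSE-PAIR∘ modulo INTER₀∘» and, with ✓p784179, «GAP♯∘ modulo {TUBE-REG∘, INTER₀∘, Thm-1 letter}» — INTER₀∘ = the second half of Lemma 1 [Balaban1985RegularSpaces]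
for one block level on the finest lattice: in the relative comb-axial gauge every bond JOINING two neighbouring blocks is within `α₁ + C·α₀` (its block average's discrepancy plus a
comb-fan∕mean-of-near-identical error).  HONEST: a reduction over landed comb-axial theorems; INTER₀∘, TUBE-REG∘, GAP♯∘, EXW∘, S2β, crux 20520 are NOT proved here; no summit statement is
proved by a helper; finite-volume ∕ conditional; rung R3 = SU(2) YM₃ on T³ — NOT d = 4, NOT infinite volume, NOT a mass gap, NOT Clay; the Yang–Mills mass gap is NOT proved.
Sorry-free, axioms standard.

References: T. Bałaban, CMP **99** (1985) 75–102 [Balaban1985RegularSpaces] ((1.19) p.79, Lemma 1 (1.24)–(1.26) pp.79–80); CMP **98** (1985) 17–51 [Balaban1985Averaging] (pp.24–25);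
CMP **102** (1985) 255–275 [Balaban1985UV3] ((12)–(13) p.259).
-/

set_option autoImplicit false

noncomputable section

open MeasureTheory Filter Topology Set
open scoped Matrix.Norms.L2Operator
open Literature.MathematicalPhysics.QuantumFieldTheory.Balaban1983to89
open Literature.MathematicalPhysics.QuantumFieldTheory.Balaban1983to89.T3ContinuumYM3Torus
open Literature.MathematicalPhysics.QuantumFieldTheory.Balaban1983to89.T3UnitLawDensityEML
open Literature.MathematicalPhysics.QuantumFieldTheory.Balaban1983to89.T3UnitScaleTilt
open Literature.MathematicalPhysics.QuantumFieldTheory.Balaban1983to89.T3TiltDescent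
open Literature.MathematicalPhysics.QuantumFieldTheory.Balaban1983to89.T3PrintedRegularMinimiser
open Literature.MathematicalPhysics.QuantumFieldTheory.Balaban1983to89.T3PrintedRegularOrbits
open Literature.MathematicalPhysics.QuantumFieldTheory.Balaban1983to89.T3ConstrainedMinimiser (fibre)
open Literature.MathematicalPhysics.QuantumFieldTheory.Balaban1983to89.Missing
open Literature.MathematicalPhysics.QuantumFieldTheory.Balaban1983to89.T4Continuum
open B10Eq27TorusAxialLog (axialT gaugeActT gaugeActT_eq_gaugeAct)
open B5Eq118OneStroke (iterBlockOf)
open B15DeterminingSets (embIter)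
open Summit.QuantumFields.YangMills.Theorems.Prop7AxialGauge (exists_axialGauge)
open Summit.QuantumFields.YangMills.Theorems.Prop7AxialGaugeBlock (dist1_mul_inv_le_interior)
open Summit.QuantumFields.YangMills.Theorems.FluctuationComparisonRegPrIntLS2BetaOneStepShift

namespace Summit.QuantumFields.YangMills.Theorems.FluctuationComparisonRegPrIntLS2BetaOneStepOfInterBlock

/-! ## §1 ONE-STEP-ROOTED₀∘ from the crossing-bond letter -/

/-- ★★ **INTER₀∘ ⟹ ONE-STEP-ROOTED₀∘** — the intra-block half of [Balaban1985RegularSpaces] Lemma 1 is the tree's (✓`exists_axialGauge` with `k = 1`, ✓`dist1_mul_inv_le_interior`);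
only the crossing bonds are displayed.  Constant `C + 6L`. [cite: Balaban1985RegularSpaces, Lemma 1 (1.24)-(1.26) pp.79-80; Balaban1985Averaging, pp.24-25] -/
theorem oneStepRooted₀_of_interBlock
    (hI : ∀ (L : ℕ), ∃ C : ℝ, 0 ≤ C ∧ ∃ a₀ : ℝ, 0 < a₀ ∧ ∀ (F : T3Family), F.L = L → ∀ (K' : ℕ), 0 < K' →
      ∀ (W Y : GaugeField (F.P K') 0 (Matrix.specialUnitaryGroup (Fin 2) ℂ)) (α₀ α₁ : ℝ), 0 ≤ α₀ → α₀ ≤ a₀ → 0 ≤ α₁ →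
        PlaqSmall α₀ Y → PlaqSmall α₀ W →
        (∀ x : Site (F.P K') 0, axialT W (embIter 1 (iterBlockOf 1 x)) x = axialT Y (embIter 1 (iterBlockOf 1 x)) x) →
        (∀ b : PBond (F.P K') 1,
          dist1 (((BlockAveraging.blockAvg (P := F.P K') (j := 0) ℰp).avg W) b *
            (((BlockAveraging.blockAvg (P := F.P K') (j := 0) ℰp).avg Y) b)⁻¹) ≤ α₁) →
        ∀ (x : Site (F.P K') 0) (μ : Fin (F.P K').d), iterBlockOf 1 (x.shift μ) ≠ iterBlockOf 1 x →
          dist1 (W ⟨x, μ⟩ * (Y ⟨x, μ⟩)⁻¹) ≤ α₁ + C * α₀) :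
    ∀ (L : ℕ), ∃ C : ℝ, 0 ≤ C ∧ ∃ a₀ : ℝ, 0 < a₀ ∧ ∀ (F : T3Family), F.L = L → ∀ (K' : ℕ), 0 < K' →
      ∀ (Y Y' : GaugeField (F.P K') 0 (Matrix.specialUnitaryGroup (Fin 2) ℂ)) (α₀ α₁ : ℝ), 0 ≤ α₀ → α₀ ≤ a₀ → 0 ≤ α₁ →
        PlaqSmall α₀ Y → PlaqSmall α₀ Y' →
        (∀ b : PBond (F.P K') 1,
          dist1 (((BlockAveraging.blockAvg (P := F.P K') (j := 0) ℰp).avg Y') b *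
            (((BlockAveraging.blockAvg (P := F.P K') (j := 0) ℰp).avg Y) b)⁻¹) ≤ α₁) →
        ∃ w : Site (F.P K') 0 → Matrix.specialUnitaryGroup (Fin 2) ℂ,
          (fun y => w (emb y)) = (fun _ => 1) ∧ ∀ ℓ : PBond (F.P K') 0, dist1 (Y' ℓ * ((GaugeField.gaugeAct w Y) ℓ)⁻¹) ≤ α₁ + C * α₀ := by
  intro L
  obtain ⟨C, hC, a₀, ha₀, H⟩ := hI L
  refine ⟨C + 6 * L, by positivity, a₀, ha₀, fun F hFL K' hK' Y Y' α₀ α₁ hα₀ hα₀a hα₁ hY hY' havg => ?_⟩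
  have hk : 1 ≤ (F.P K').m + (F.P K').K := by show 1 ≤ F.m + K'; omega
  -- the rooted comb-axial element of `Y'` relative to `Y`
  obtain ⟨v, hv1, hax⟩ := exists_axialGauge (P := F.P K') (k := 1) hk Y Y'
  have hvemb : (fun y : Site (F.P K') 1 => v (emb y)) = fun _ => 1 := funext fun y => hv1 y
  set W : GaugeField (F.P K') 0 (Matrix.specialUnitaryGroup (Fin 2) ℂ) := GaugeField.gaugeAct v Y' with hW
  have haxW : ∀ x : Site (F.P K') 0, axialT W (embIter 1 (iterBlockOf 1 x)) x = axialT Y (embIter 1 (iterBlockOf 1 x)) x := by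
    intro x; rw [hW, ← gaugeActT_eq_gaugeAct]; exact hax x
  have hWsmall : PlaqSmall α₀ W := (plaqSmall_gaugeAct_iff' α₀ v Y').mpr hY'
  -- `W` has the same one-step average as `Y'` (the gauging element is `1` at the centres)
  have havgW : (BlockAveraging.blockAvg (P := F.P K') (j := 0) ℰp).avg W =
      (BlockAveraging.blockAvg (P := F.P K') (j := 0) ℰp).avg Y' := by
    rw [hW, (BlockAveraging.blockAvg (P := F.P K') (j := 0) ℰp).covariant hk v Y', hvemb]
    exact B12RTGaugeInvariance254.gaugeAct_one' _
  have havg' : ∀ b : PBond (F.P K') 1,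
      dist1 (((BlockAveraging.blockAvg (P := F.P K') (j := 0) ℰp).avg W) b *
        (((BlockAveraging.blockAvg (P := F.P K') (j := 0) ℰp).avg Y) b)⁻¹) ≤ α₁ := by
    intro b; rw [havgW]; exact havg b
  -- every bond: interior by the tree, crossing by INTER₀∘
  have hbond : ∀ ℓ : PBond (F.P K') 0, dist1 (W ℓ * (Y ℓ)⁻¹) ≤ α₁ + (C + 6 * L) * α₀ := by
    rintro ⟨x, μ⟩
    by_cases hblock : iterBlockOf 1 (x.shift μ) = iterBlockOf 1 x
    · have h := dist1_mul_inv_le_interior (k := 1) hk W Y hα₀ hα₀ hWsmall hY haxW x μ hblock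
      have hd : ((F.P K').d : ℝ) = 3 := by norm_num [T3Family.P_d]
      have hLL : ((F.P K').L : ℝ) = L := by rw [← hFL]; rfl
      rw [hd, hLL, pow_one] at h
      have hL0 : (0 : ℝ) ≤ L := Nat.cast_nonneg _
      nlinarith
    · have h := H F hFL K' hK' W Y α₀ α₁ hα₀ hα₀a hα₁ hY hWsmall haxW havg' x μ hblock
      have hL0 : (0 : ℝ) ≤ L := Nat.cast_nonneg _
      nlinarith
  -- the rooted transformation `w := v⁻¹`
  refine ⟨fun x => (v x)⁻¹, funext fun y => ?_, fun ℓ => ?_⟩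
  · show (v (emb y))⁻¹ = 1
    rw [show v (emb y) = 1 from hv1 y, inv_one]
  have hconj : Y' ℓ * ((GaugeField.gaugeAct (fun x => (v x)⁻¹) Y) ℓ)⁻¹ = (v ℓ.src)⁻¹ * (W ℓ * (Y ℓ)⁻¹) * ((v ℓ.src)⁻¹)⁻¹ := by
    rw [hW]
    show Y' ℓ * ((v ℓ.src)⁻¹ * Y ℓ * ((v ℓ.tgt)⁻¹)⁻¹)⁻¹ = (v ℓ.src)⁻¹ * ((v ℓ.src * Y' ℓ * (v ℓ.tgt)⁻¹) * (Y ℓ)⁻¹) * ((v ℓ.src)⁻¹)⁻¹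
    group
  rw [hconj, GaugeGroup.dist1_conj]
  exact hbond ℓ

/-! ## §2 CLOSE-PAIR∘ from the crossing-bond letter -/

/-- ★★★ **INTER₀∘ ⟹ CLOSE-PAIR∘** (§1 ∘ ✓`closePair_of_oneStepRooted₀`): the kinematic letter of GAP♯∘ reduced to the SECOND half of [Balaban1985RegularSpaces] Lemma 1 (the
bonds joining two blocks, from the averaging constraint) for one block level on the finest lattice. [cite: Balaban1985RegularSpaces, Lemma 1 (1.25) p.79; Balaban1985UV3, (12)-(13) p.259] -/
theorem closePair_of_interBlock
    (hI : ∀ (L : ℕ), ∃ C : ℝ, 0 ≤ C ∧ ∃ a₀ : ℝ, 0 < a₀ ∧ ∀ (F : T3Family), F.L = L → ∀ (K' : ℕ), 0 < K' →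
      ∀ (W Y : GaugeField (F.P K') 0 (Matrix.specialUnitaryGroup (Fin 2) ℂ)) (α₀ α₁ : ℝ), 0 ≤ α₀ → α₀ ≤ a₀ → 0 ≤ α₁ →
        PlaqSmall α₀ Y → PlaqSmall α₀ W →
        (∀ x : Site (F.P K') 0, axialT W (embIter 1 (iterBlockOf 1 x)) x = axialT Y (embIter 1 (iterBlockOf 1 x)) x) →
        (∀ b : PBond (F.P K') 1,
          dist1 (((BlockAveraging.blockAvg (P := F.P K') (j := 0) ℰp).avg W) b *
            (((BlockAveraging.blockAvg (P := F.P K') (j := 0) ℰp).avg Y) b)⁻¹) ≤ α₁) →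
        ∀ (x : Site (F.P K') 0) (μ : Fin (F.P K').d), iterBlockOf 1 (x.shift μ) ≠ iterBlockOf 1 x →
          dist1 (W ⟨x, μ⟩ * (Y ⟨x, μ⟩)⁻¹) ≤ α₁ + C * α₀) :
    ∀ (L : ℕ) (b₀ p₀ : ℝ), 0 < b₀ → 0 < p₀ → ∀ (δ : ℝ), 0 < δ →
      ∃ γ₁ : ℝ, 0 < γ₁ ∧ ∀ (F : T3Family) (γ : ℝ), F.L = L → 0 < γ → γ ≤ γ₁ →
        ∀ (J K : ℕ) (hJK : J ≤ K) (V : GaugeField (F.P J) 0 (Matrix.specialUnitaryGroup (Fin 2) ℂ)),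
          ∀ U' ∈ fibre F ℰp J K hJK V, U' ∈ histGood F ℰp (θBal F.L γ b₀ p₀) K J →
            ∀ U ∈ fibre F ℰp J K hJK V, U ∈ histGood F ℰp (θBal F.L γ b₀ p₀) K J →
              ∃ w : Site (F.P K) 0 → Matrix.specialUnitaryGroup (Fin 2) ℂ,
                (∀ U'' : GaugeField (F.P K) 0 (Matrix.specialUnitaryGroup (Fin 2) ℂ),
                    descendTo F ℰp J K hJK (GaugeField.gaugeAct w U'') = descendTo F ℰp J K hJK U'') ∧
                  ∀ ℓ : PBond (F.P K) 0, dist1 (U ℓ * ((GaugeField.gaugeAct w U') ℓ)⁻¹) ≤ δ :=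
  closePair_of_oneStepRooted₀ (oneStepRooted₀_of_interBlock hI)

end Summit.QuantumFields.YangMills.Theorems.FluctuationComparisonRegPrIntLS2BetaOneStepOfInterBlock

end
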